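import Literature.Topology.FourManifolds.RegularSublevelSet
import Literature.Topology.FourManifolds.SeamBicollar
import Mathlib.Geometry.Manifold.PartitionOfUnity
import HarnessLib

/-!
# Smooth functions on a regular domain extend to the ambient manifold (Seeley)

Topic `Literature/Topology/FourManifolds` (fact seat
`provefact-Literature.Topology.FourManifolds.IsHandlebody.exists_diffeomorph_isBoundaryGluing_sphere`,
step F2b₁ of the Lickorish–Wallace DAG; first layer of the *level normalisation* of a
diffeomorphism of sublevel sets needed to feed the uniqueness of attaching one `1`-handle, L1
`oneHandle_nonempty_diffeomorph`, into the level-compatible handle-extension machinery of the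
tree: the comparison function `f' ∘ Ψ₀` of a diffeomorphism `Ψ₀ : {f ≤ a} ≅ {f' ≤ a'}` is
smooth *up to the boundary* of the sublevel set, and is extended here to a smooth function on
the ambient manifold).  Everything here is **proved**; no named facts.

* `HalfSliceAtlas.contDiffOn_comp_extend_symm` — a function `C^∞` on a regular domain `S ⊆ M`
  (structure `HalfSliceAtlas.chartedSpace`, `RegularSublevelSet.lean`), read in a half-slice
  chart `Θ`, is `C^∞` on `Θ.target ∩ {z | 0 ≤ z 0}` in the within sense;
* `HalfSliceAtlas.exists_contMDiffOn_eq_nhds` — hence, by **Seeley's extension theorem** in the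
  coordinates of the half space (`exists_contDiffOn_extension_halfSpace`, `SeamBicollar.lean`;
  R. T. Seeley, Proc. AMS 15 (1964)), it agrees near any point of `S` with a function `C^∞` on
  an open set of `M`;
* `HalfSliceAtlas.exists_contMDiff_forall_eq` — **global extension**: for `S` closed in a
  σ-compact Hausdorff `M`, every `C^∞` function `g : S → F` (values in a complete normed space)
  is the restriction of a `C^∞` function `G : M → F`; the local extensions (and `0` off `S`) are
  glued by a smooth partition of unity (Mathlib's
  `exists_contMDiffMap_forall_mem_convex_of_local`, with the convex constraint `G y ∈ {g y}` on
  `S`).  Lee, *Introduction to Smooth Manifolds* (2013), Lemma 2.26 (extension lemma for smooth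
  functions on closed sets) with Prop. 5.47 / Thm. 5.48 (regular domains);
* `exists_contMDiff_forall_eq_sublevel` — the case of a regular sublevel set `{f ≤ a}` with the
  structure `sublevelAtlas` (Milnor 1965, Lemma 2.9).

## References

* R. T. Seeley, *Extension of `C^∞` functions defined in a half space*, Proc. AMS 15 (1964),
  625–626. [Seeley1964]
* J. M. Lee, *Introduction to Smooth Manifolds*, 2nd ed., GTM 218 (2013), Lemma 2.26,
  Prop. 5.47, Thm. 5.48, Cor. 5.30. [LeeSmoothManifolds2013]
* J. Milnor, *Lectures on the h-cobordism theorem* (1965), Lemma 2.9. [MilnorHCobordism1965]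
-/

open scoped Manifold ContDiff Topology
open Set Function

noncomputable section

namespace Literature.Topology.FourManifolds

universe u

/-- Local notation: `𝔼 n` is the model Euclidean space `EuclideanSpace ℝ (Fin n)`. -/
local notation "𝔼 " n:arg => EuclideanSpace ℝ (Fin n)

namespace HalfSliceAtlas

variable {k : ℕ} {M : Type u} [TopologicalSpace M] [ChartedSpace (EuclideanHalfSpace (k + 1)) M]
  {S : Set M} (Φ : HalfSliceAtlas (𝓡∂ (k + 1)) S)
  {F : Type*} [NormedAddCommGroup F] [NormedSpace ℝ F]

/-- **A smooth function on a regular domain, read in a half-slice chart.**  If `g : S → F` is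
`C^∞` for `Φ.chartedSpace`, then on the target half of the half-slice chart `Θ = (Φ.datum p).Θ`
the function `z ↦ g (Θ⁻¹ z)` (precisely: `g` composed with the inverse extended chart of `S` at
`p`) is `C^∞` within `Θ.target ∩ {z | 0 ≤ z 0}` — the extended chart of `S` at `p` *is* `Θ|_S`.
[cite: LeeSmoothManifolds2013, Thm. 5.48] -/
theorem contDiffOn_comp_extend_symm {g : S → F}
    (hg : letI := Φ.chartedSpace; ContMDiff (𝓡∂ (k + 1)) 𝓘(ℝ, F) ∞ g) (p : S) :
    letI := Φ.chartedSpace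
    ContDiffOn ℝ ∞ (g ∘ (extChartAt (𝓡∂ (k + 1)) p).symm)
      ((Φ.datum p).Θ.target ∩ {z | 0 ≤ z 0}) := by
  letI := Φ.chartedSpace
  haveI := Φ.isManifold
  set D := Φ.datum p with hD
  have hs : (extChartAt (𝓡∂ (k + 1)) p).source ⊆ (extChartAt (𝓡∂ (k + 1)) p).source := Subset.rfl
  have h2s : MapsTo g (extChartAt (𝓡∂ (k + 1)) p).source (extChartAt 𝓘(ℝ, F) (g p)).source := by
    intro q _; simp
  have h := (contMDiffOn_iff_of_subset_source' hs h2s).1 hg.contMDiffOn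
  rw [extChartAt_model_space_eq_id, PartialEquiv.image_source_eq_target] at h
  have htgt : (extChartAt (𝓡∂ (k + 1)) p).target = D.Θ.target ∩ {z | 0 ≤ z 0} := by
    ext z
    rw [show extChartAt (𝓡∂ (k + 1)) p = (D.chart p).extend (𝓡∂ (k + 1)) from rfl,
      D.mem_extend_chart_target, mem_inter_iff, mem_setOf_eq, and_comm]
  rw [htgt] at h
  exact h

/-- **Local extension across the boundary of a regular domain (Seeley).**  A `C^∞` function
`g : S → F` on a regular domain (values in a complete normed space) agrees, near any point
`p ∈ S`, with a function `C^∞` on an open set of the ambient manifold: read `g` in the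
half-slice chart at `p` (`contDiffOn_comp_extend_symm`), extend across the hyperplane by
Seeley's theorem (`exists_contDiffOn_extension_halfSpace`) and pull back along the chart.
[cite: Seeley1964, Theorem] -/
theorem exists_contMDiffOn_eq_nhds [CompleteSpace F] {g : S → F}
    (hg : letI := Φ.chartedSpace; ContMDiff (𝓡∂ (k + 1)) 𝓘(ℝ, F) ∞ g) (p : S) :
    ∃ U : Set M, IsOpen U ∧ p.1 ∈ U ∧ ∃ G : M → F, ContMDiffOn (𝓡∂ (k + 1)) 𝓘(ℝ, F) ∞ G U ∧
      ∀ (y : M) (hy : y ∈ S), y ∈ U → G y = g ⟨y, hy⟩ := by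
  letI := Φ.chartedSpace
  haveI := Φ.isManifold
  set D := Φ.datum p with hD
  have hpsrc : p.1 ∈ D.Θ.source := Φ.mem_source p
  -- read `g` in the chart and extend by Seeley
  obtain ⟨V, hVo, hpV, hVU, Gc, hGc, hGceq⟩ := exists_contDiffOn_extension_halfSpace D.Θ.open_target
    (D.Θ.map_source hpsrc) (Φ.contDiffOn_comp_extend_symm hg p)
  -- pull back along `Θ`
  refine ⟨D.Θ.source ∩ D.Θ ⁻¹' V, D.Θ.continuousOn.isOpen_inter_preimage D.Θ.open_source hVo,
    ⟨hpsrc, hpV⟩, Gc ∘ D.Θ, ?_, ?_⟩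
  · have hGc' : ContMDiffOn 𝓘(ℝ, 𝔼 (k + 1)) 𝓘(ℝ, F) ∞ Gc V := contMDiffOn_iff_contDiffOn.2 hGc
    exact hGc'.comp (D.contMDiffOn_toFun.mono inter_subset_left) fun y hy => hy.2
  · intro y hyS hy
    have hy0 : 0 ≤ D.Θ y 0 := D.apply_zero_nonneg hy.1 hyS
    have hyt : D.Θ y ∈ D.Θ.target := D.Θ.map_source hy.1
    rw [comp_apply, hGceq ⟨hy.2, hy0⟩, comp_apply]
    congr 1
    ext1
    rw [show extChartAt (𝓡∂ (k + 1)) p = (D.chart p).extend (𝓡∂ (k + 1)) from rfl,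
      D.coe_extend_chart_symm_of_mem hy0 hyt, D.Θ.left_inv hy.1]

/-- **Smooth functions on a closed regular domain extend to the ambient manifold.**  Let `S ⊆ M`
be a closed regular domain (half-slice atlas `Φ`, structure `Φ.chartedSpace`) of a σ-compact
Hausdorff manifold with boundary `M`, and `g : S → F` a `C^∞` function with values in a
complete normed space.  Then `g = G|_S` for a `C^∞` function `G : M → F`.  Proof: locally near
points of `S` by Seeley's theorem (`exists_contMDiffOn_eq_nhds`), by `0` off the closed set `S`;
these local functions are glued by a smooth partition of unity through Mathlib's
`exists_contMDiffMap_forall_mem_convex_of_local` with the convex constraints `G y ∈ {g y}`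
(`y ∈ S`), `G y ∈ univ` (`y ∉ S`).  Lee (2013), Lemma 2.26 with Thm. 5.48.
[cite: LeeSmoothManifolds2013, Lemma 2.26] [cite: Seeley1964, Theorem] -/
theorem exists_contMDiff_forall_eq [IsManifold (𝓡∂ (k + 1)) ∞ M] [T2Space M] [SigmaCompactSpace M]
    [CompleteSpace F]
    (hS : IsClosed S) {g : S → F}
    (hg : letI := Φ.chartedSpace; ContMDiff (𝓡∂ (k + 1)) 𝓘(ℝ, F) ∞ g) :
    ∃ G : M → F, ContMDiff (𝓡∂ (k + 1)) 𝓘(ℝ, F) ∞ G ∧ ∀ y : S, G y = g y := by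
  classical
  -- the convex constraint
  let t : M → Set F := fun y => if h : y ∈ S then {g ⟨y, h⟩} else univ
  have ht : ∀ y, Convex ℝ (t y) := by
    intro y
    by_cases h : y ∈ S
    · simp only [t, h, ↓reduceDIte]; exact convex_singleton _
    · simp only [t, h, ↓reduceDIte]; exact convex_univ
  have Hloc : ∀ x : M, ∃ U ∈ 𝓝 x, ∃ G : M → F,
      ContMDiffOn (𝓡∂ (k + 1)) 𝓘(ℝ, F) ∞ G U ∧ ∀ y ∈ U, G y ∈ t y := by
    intro x
    by_cases hx : x ∈ S
    · obtain ⟨U, hUo, hxU, G, hG, hGeq⟩ := Φ.exists_contMDiffOn_eq_nhds hg ⟨x, hx⟩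
      refine ⟨U, hUo.mem_nhds hxU, G, hG, fun y hy => ?_⟩
      by_cases hyS : y ∈ S
      · simp only [t, hyS, ↓reduceDIte, mem_singleton_iff]
        exact hGeq y hyS hy
      · simp only [t, hyS, ↓reduceDIte, mem_univ]
    · refine ⟨Sᶜ, hS.isOpen_compl.mem_nhds hx, fun _ => 0, contMDiffOn_const, fun y hy => ?_⟩
      have hyS : y ∉ S := hy
      simp only [t, hyS, ↓reduceDIte, mem_univ]
  obtain ⟨G, hG⟩ := exists_contMDiffMap_forall_mem_convex_of_local (𝓡∂ (k + 1)) ht Hloc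
  refine ⟨G, G.contMDiff, fun y => ?_⟩
  have := hG y
  simp only [t, y.2, ↓reduceDIte, mem_singleton_iff, Subtype.coe_eta] at this
  exact this

end HalfSliceAtlas

/-- **Smooth functions on a regular sublevel set extend to the ambient manifold.**  For a smooth
function `f` on a σ-compact Hausdorff manifold with boundary `M` and a regular level `a` with
`{f ≤ a}` in the interior (structure `sublevelAtlas`, Milnor 1965, Lemma 2.9), every `C^∞`
function `g : {f ≤ a} → F` (complete normed space `F`) is the restriction of a `C^∞` function
on `M`. [cite: LeeSmoothManifolds2013, Lemma 2.26] [cite: MilnorHCobordism1965, Lemma 2.9] -/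
theorem exists_contMDiff_forall_eq_sublevel {k : ℕ} {M : Type u} [TopologicalSpace M]
    [ChartedSpace (EuclideanHalfSpace (k + 1)) M] [IsManifold (𝓡∂ (k + 1)) ∞ M] [T2Space M]
    [SigmaCompactSpace M] {F : Type*} [NormedAddCommGroup F] [NormedSpace ℝ F] [CompleteSpace F]
    {f : M → ℝ} (hf : ContMDiff (𝓡∂ (k + 1)) 𝓘(ℝ, ℝ) ∞ f) {a : ℝ}
    (hint : ∀ p, f p ≤ a → (𝓡∂ (k + 1)).IsInteriorPoint p)
    (hreg : ∀ p, f p = a → ¬ IsMCriticalPt (𝓡∂ (k + 1)) f p) {g : ↥(f ⁻¹' Iic a) → F}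
    (hg : letI := (sublevelAtlas hf a hint hreg).chartedSpace
      ContMDiff (𝓡∂ (k + 1)) 𝓘(ℝ, F) ∞ g) :
    ∃ G : M → F, ContMDiff (𝓡∂ (k + 1)) 𝓘(ℝ, F) ∞ G ∧ ∀ y : ↥(f ⁻¹' Iic a), G y = g y :=
  (sublevelAtlas hf a hint hreg).exists_contMDiff_forall_eq (isClosed_Iic.preimage hf.continuous) hg

end Literature.Topology.FourManifolds

end
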